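import Summits.ABC.IUTFork.Repair.RHReachLedgerRealiseLocal
import Summits.ABC.IUTFork.Repair.RHReachLedgerDoor
import HarnessLib

/-!
# R-H ROUND 2, row 27 «reach-ledger» — THE W-RELATIVE DOORS: dictionary, certificates and column domination asked ONLY AT THE PRIMES
# UNDER A BAD PLACE; the packets over every other prime are paid by identity movers

PROOF-ONLY file (0 definitions, 0 `Prop` facts; abc-iut cell, D-0079 RESCUE sub-cell R-H, rung LADDER-ABC:A2.RESCUE.H; ROUND-2 seat
abc-iut-rh2-L1 gen 2). TAKES NO SIDE on [IUTchIII] Cor. 3.12 or on any author; `HStarReachLedger` (abc-iut-lens-nearmiss-1, p464022) is an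
R-H CANDIDATE = a HYPOTHESIS SHAPE, never asserted; typed ≠ proved; instantiated ≠ endorsed; nothing here asserts abc proved or refuted.
Inputs BY NAME: `ReachLedgerRealise.placeSum_le_cellSlack_at` (the per-prime (α), `Repair/RHReachLedgerRealiseLocal.lean`), abc-iut-rh-typ-10's
generic door `RH.ReachLedgerBookkeeping.statement_of_minorant_total_nonneg_on` and free packets `cellSlack_nonneg_settingPrVolSharp_inl` /
`cellSlack_nonneg_settingPrVolSharp_of_good` (p474654), gen 0's §0 integer bookkeeping `cellReachSlack_succ_le_realised`,
`sum_cellReachSlack_nonneg_of_ledgerCell`, `rOutSharp_le_one`, `one_le_innerCond` (p475842), abc-iut-c312-7's `finite_primes_under_S`.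

WHAT IS PROVED. Gen 0's doors `statement_of_placeLedger` / `statement_of_hStarReachLedger(_of_badColumns)` ask a certified uniform
dictionary `(e_p, ϖ, A_p, B_p)` at EVERY prime `p` — also at the primes with no bad place over them, where nothing is financed but where
such a dictionary may fail to exist (non-uniform fibres; inner ties `(p−1) ∣ e`, in particular EVERY place over `2`). Here:
* `statement_of_placeLedger_on` — ROW 27's DOOR IN PLACE CURRENCY with `e_p ≥ 1`, `B_p ≤ A_p`, `‖ϖ_x‖ = p^{−1/e_p}` and the two certificates
  asked only at primes `p` UNDER A BAD PLACE (hypothesis shape `∀ p w, placeOf w ∈ S → …`); globally only `ϖ ≠ 0`, `s = 0` off `S`.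
  Proof: typ-10's `statement_of_minorant_total_nonneg_on` with `W :=` the primes under `S` carrying a bad fibre point, the minorant
  `(log p/e_p)·Σ_{v∣p}(n_v/[F:ℚ])·s(p,i,v)` there (`placeSum_le_cellSlack_at`), `0 ≤ σ` elsewhere by the free packets.
* `statement_of_hStarReachLedger_on` — THE ROW-27 DOOR `HStarReachLedger ⟹ Statement` with the dictionary, the realising profile
  `mΘ = (i+1)²·mq`, the ledger's index `e_w = e_p` and the column domination `innerCond p e_p ≤ A_p`, `B_p ≤ rOutSharp p e_p` all asked at
  the bad places / the primes under them ONLY.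
So the residual binders of row 27 at a datum live at its BAD PRIMES alone; the genuine-bed sequel discharges them off the ties.
HONEST SCOPE as in gen 0: «Statement follows from the ledger AS TYPED + the certificates at the bad primes», nothing about which genuine
data satisfy the ledger (rh-num-1's tables). OUR typed objects (Dupuy–Hilado (Ind2) — STRONGER-THAN-PRINT; sharp boxes; hull-level (xi-f)).
[cite: DupuyHilado2025, §3.6, §3.9, §4.9] [cite: Mochizuki2012, IUTchI Ex. 3.2 (iv) p. 71; IUTchIII Prop. 3.9 (i) p. 116, Rmk. 3.9.3 pp. 119–120,
Cor. 3.12 p. 173–174] [claim: Mochizuki2012, status: disputed]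
-/

noncomputable section

open Set Function
open scoped Pointwise

namespace Summit.ABC.IUTFork.Repair.RH.ReachLedgerDoor

open Cor312 Cor312Vol Literature.IUT.LogThetaLattice Literature.IUT.LogVolume NumberField IsDedekindDomain
  Summit.ABC.IUTFork.Thm311 Summit.ABC.IUTFork.Thm311.Real Summit.ABC.IUTFork.Repair.RH.ReachLedger
  Summit.ABC.IUTFork.Repair.RH.ReachLedgerRealise Summit.ABC.IUTFork.Repair.RH.ReachLedgerBookkeeping

section Sharp

variable {F : Type} [Field F] [NumberField F] (X : PilotData F) {logv : PadicLogs F} (hlog : LogvAnalytic logv)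
  (M : Type) [Field M] [NumberField M]
  (archPk : ∀ (j : (thetaIndex X).Label) (vQ : (thetaIndex X).VQ), Set ((logShellsDH X logv).Packet j vQ))
  (archSub : ∀ (j : (thetaIndex X).Label) (v : (thetaIndex X).V),
    Set ((logShellsDH X logv).Packet j ((thetaIndex X).over v)))
  (Ψ : ℤ → ∀ v : (thetaIndex X).V, v ∈ (thetaIndex X).Vbad → Set ((logShellsDH X logv).StarPacket v))
  (act : ℤ → ∀ v : (thetaIndex X).V, v ∈ (thetaIndex X).Vbad →
    (logShellsDH X logv).StarPacket v → Module.End ℚ ((logShellsDH X logv).StarPacket v))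
  (Mmod : ℤ → ∀ j : (thetaIndex X).LabelStar, Set ((logShellsDH X logv).GlobalPacket j.1))
  (region : ℤ → ∀ j : (thetaIndex X).LabelStar, FinDivisor M → ∀ vQ : (thetaIndex X).VQ,
    Set ((logShellsDH X logv).Packet j.1 vQ))
  (n : ℤ) {HT : Type} {LogLink : HT → HT → Type} {IsFull : ∀ {s t : HT}, LogLink s t → Prop}
  (lat : LGPGaussianLogThetaLattice LogLink IsFull)
  {Frd : Type} {IsoF : Frd → Frd → Type} {Ob : Frd → Type} {realify : Frd → Frd} {Strip : Type}
  {IsoS : Strip → Strip → Type} {Mv : ∀ v : (thetaIndex X).V, v ∈ (thetaIndex X).Vbad → Type}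
  [∀ v h, Monoid (Mv v h)]
  (sig : GlobalLGPFrobenioidSignature (thetaIndex X).lstar (thetaIndex X).V (· ∈ (thetaIndex X).Vbad)
    Frd IsoF Ob realify Strip IsoS Mv)
  (split : SplittingMonoids Mv) {ObΔ : Type} {N : ∀ v : (thetaIndex X).V, v ∈ (thetaIndex X).Vbad → Type}
  [∀ v h, Monoid (N v h)] (qData : QPilotData ObΔ N)
  (tq : ∀ (pp : Nat.Primes) (x : (thetaIndex X).Fibre (.inr pp)), haveI : Fact (pp : ℕ).Prime := ⟨pp.2⟩; kOf X pp.1 x)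
  (t : ∀ (pp : Nat.Primes) (_ : Fin X.lstar) (x : (thetaIndex X).Fibre (.inr pp)),
    haveI : Fact (pp : ℕ).Prime := ⟨pp.2⟩; kOf X pp.1 x)
  (htq0 : ∀ pp x, tq pp x ≠ 0)
  (htq1 : ∀ (pp : Nat.Primes) (x : (thetaIndex X).Fibre (.inr pp)),
    haveI : Fact (pp : ℕ).Prime := ⟨pp.2⟩; placeOf X pp.1 x ∉ X.S → ‖tq pp x‖ = 1)

section Dictionary

variable (eK AK : Nat.Primes → ℕ) (BK : Nat.Primes → ℤ)
  (ϖ : ∀ (pp : Nat.Primes) (x : (thetaIndex X).Fibre (.inr pp)), haveI : Fact (pp : ℕ).Prime := ⟨pp.2⟩; kOf X pp.1 x)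
  (mΘ : ∀ pp : Nat.Primes, Fin (thetaIndex X).lstar → (thetaIndex X).Fibre (.inr pp) → ℤ)
  (mq : ∀ pp : Nat.Primes, (thetaIndex X).Fibre (.inr pp) → ℤ)
  (s : ∀ pp : Nat.Primes, Fin (thetaIndex X).lstar → (thetaIndex X).Fibre (.inr pp) → ℤ)

/-! ## §1. ROW 27's DOOR IN PLACE CURRENCY, dictionary at the primes under a bad place only -/

/-- **ROW 27's DOOR, PLACE CURRENCY, W-RELATIVE.** At `settingPrVolSharp` (bridge hypotheses): `ϖ_x ≠ 0` everywhere; integers `s(p,i,x)`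
vanishing off `S`, realisable at the bad places (`s ≤ mq − (i+2)·B_p − e_p·⌈(mΘ − (i+2)(A_p+e_p−1))/e_p⌉`) and with NONNEGATIVE LABEL SUM
`0 ≤ Σ_{i<l⋆} s(p,i,w)` at every bad `w`; and — ONLY at the primes `p` lying UNDER A BAD PLACE — a certified uniform dictionary: `e_p ≥ 1`,
`B_p ≤ A_p`, norm uniformizers `‖ϖ_x‖ = p^{−1/e_p}` for all `x ∣ p`, an inner certificate (a NON-log-unit of norm `≤ ‖ϖ_x‖^{A_p−1}` at every
`x ∣ p`) and an outer certificate (a log-unit of norm `≥ p^{−B_p/e_p}`). THEN the typed [IUTchIII] Cor. 3.12 `Statement` holds. The packets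
over primes with no bad place are paid by identity movers (abc-iut-rh-typ-10's `cellSlack_nonneg_settingPrVolSharp_of_good`), the archimedean
ones by the trivial container; the rest is gen 0's `statement_of_placeLedger` over the per-prime (α). «Statement follows from the surpluses
AS TYPED», nothing more. [cite: Mochizuki2012, IUTchIII Prop. 3.9 (i) p. 116, Rmk. 3.9.3, Cor. 3.12 p. 173–174] [cite: DupuyHilado2025, §3.6, §3.9, §4.9]
[claim: Mochizuki2012, status: disputed] -/
theorem statement_of_placeLedger_on (ht0 : ∀ pp i x, t pp i x ≠ 0) (hϖ0 : ∀ pp x, ϖ pp x ≠ 0)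
    (ht1 : ∀ (pp : Nat.Primes) (i : Fin X.lstar) (x : (thetaIndex X).Fibre (.inr pp)),
      haveI : Fact (pp : ℕ).Prime := ⟨pp.2⟩; placeOf X pp.1 x ∉ X.S → ‖t pp i x‖ = 1)
    (hΘ : ∀ (pp : Nat.Primes) (i : Fin X.lstar) (w : (thetaIndex X).Fibre (.inr pp)), haveI : Fact (pp : ℕ).Prime := ⟨pp.2⟩
      placeOf X pp.1 w ∈ X.S → ‖t pp i w‖ = ‖ϖ pp w‖ ^ (mΘ pp i w))
    (hq : ∀ (pp : Nat.Primes) (w : (thetaIndex X).Fibre (.inr pp)), haveI : Fact (pp : ℕ).Prime := ⟨pp.2⟩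
      placeOf X pp.1 w ∈ X.S → ‖tq pp w‖ = ‖ϖ pp w‖ ^ (mq pp w))
    (hs0 : ∀ (pp : Nat.Primes) (i : Fin (thetaIndex X).lstar) (x : (thetaIndex X).Fibre (.inr pp)),
      haveI : Fact (pp : ℕ).Prime := ⟨pp.2⟩; placeOf X pp.1 x ∉ X.S → s pp i x = 0)
    (hs : ∀ (pp : Nat.Primes) (i : Fin (thetaIndex X).lstar) (w : (thetaIndex X).Fibre (.inr pp)),
      haveI : Fact (pp : ℕ).Prime := ⟨pp.2⟩; placeOf X pp.1 w ∈ X.S →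
        s pp i w ≤ mq pp w - ((i : ℤ) + 2) * BK pp -
          (eK pp : ℤ) * (-((-(mΘ pp i w - ((i : ℤ) + 2) * ((AK pp : ℤ) + eK pp - 1))) / (eK pp : ℤ))))
    (hled : ∀ (pp : Nat.Primes) (w : (thetaIndex X).Fibre (.inr pp)), haveI : Fact (pp : ℕ).Prime := ⟨pp.2⟩
      placeOf X pp.1 w ∈ X.S → 0 ≤ ∑ i : Fin (thetaIndex X).lstar, (s pp i w : ℝ))
    (he : ∀ (pp : Nat.Primes) (w : (thetaIndex X).Fibre (.inr pp)), haveI : Fact (pp : ℕ).Prime := ⟨pp.2⟩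
      placeOf X pp.1 w ∈ X.S → 1 ≤ eK pp)
    (hBA : ∀ (pp : Nat.Primes) (w : (thetaIndex X).Fibre (.inr pp)), haveI : Fact (pp : ℕ).Prime := ⟨pp.2⟩
      placeOf X pp.1 w ∈ X.S → BK pp ≤ (AK pp : ℤ))
    (hϖ : ∀ (pp : Nat.Primes) (w : (thetaIndex X).Fibre (.inr pp)), haveI : Fact (pp : ℕ).Prime := ⟨pp.2⟩
      placeOf X pp.1 w ∈ X.S → ∀ x : (thetaIndex X).Fibre (.inr pp), ‖ϖ pp x‖ = ((pp : ℕ) : ℝ) ^ (-(1 : ℝ) / (eK pp : ℝ)))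
    (hsharp : ∀ (pp : Nat.Primes) (w : (thetaIndex X).Fibre (.inr pp)), haveI : Fact (pp : ℕ).Prime := ⟨pp.2⟩
      placeOf X pp.1 w ∈ X.S → ∀ x : (thetaIndex X).Fibre (.inr pp),
        ∃ u : kOf X pp.1 x, ‖u‖ ≤ ‖ϖ pp x‖ ^ ((AK pp : ℤ) - 1) ∧ u ∉ (logUnits (kOf X pp.1 x) : Set (kOf X pp.1 x)))
    (hrad : ∀ (pp : Nat.Primes) (w : (thetaIndex X).Fibre (.inr pp)), haveI : Fact (pp : ℕ).Prime := ⟨pp.2⟩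
      placeOf X pp.1 w ∈ X.S → ∀ x : (thetaIndex X).Fibre (.inr pp),
        ∃ z ∈ (logUnits (kOf X pp.1 x) : Set (kOf X pp.1 x)), ((pp : ℕ) : ℝ) ^ (-(BK pp : ℝ) / (eK pp : ℝ)) ≤ ‖z‖)
    (HB : BridgeHyps (settingPrVolSharp X hlog M archPk archSub Ψ act Mmod region n lat sig split qData tq t htq0 htq1)) :
    (settingPrVolSharp X hlog M archPk archSub Ψ act Mmod region n lat sig split qData tq t htq0 htq1).Statement := by
  haveI hF : ∀ pp : Nat.Primes, Fact (pp : ℕ).Prime := fun pp => ⟨pp.2⟩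
  classical
  -- the per-packet lower bounds (`0` at the archimedean packets)
  let b : Fin (thetaIndex X).lstar → (thetaIndex X).VQ → ℝ := fun i vQ =>
    Sum.elim (fun _ => (0 : ℝ)) (fun pp : Nat.Primes =>
      Real.log ((pp : ℕ) : ℝ) / (eK pp : ℝ) *
        ∑ v : ↥(placesOver F pp), weight F v.1 * (s pp i ((fibreEquivPlacesOver X pp).symm v) : ℝ)) vQ
  -- the primes UNDER A BAD PLACE (finitely many: under `S`), read through a bad fibre point
  set U : Finset Nat.Primes := (finite_primes_under_S X).toFinset.filter
    (fun pp => ∃ w : (thetaIndex X).Fibre (.inr pp), placeOf X pp.1 w ∈ X.S) with hU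
  have hbadU : ∀ pp ∈ U, ∃ w : (thetaIndex X).Fibre (.inr pp), placeOf X pp.1 w ∈ X.S := fun pp hpp =>
    (Finset.mem_filter.mp hpp).2
  have hgood : ∀ pp : Nat.Primes, pp ∉ U → ∀ x : (thetaIndex X).Fibre (.inr pp), placeOf X pp.1 x ∉ X.S := by
    intro pp hpp x hx
    exact hpp (Finset.mem_filter.mpr
      ⟨(finite_primes_under_S X).mem_toFinset.mpr ⟨_, hx, natCast_mem_placeOf X pp.1 x⟩, x, hx⟩)
  refine statement_of_minorant_total_nonneg_on
    (P := settingPrVolSharp X hlog M archPk archSub Ψ act Mmod region n lat sig split qData tq t htq0 htq1) HB.finite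
    (fun _ => (U.image Sum.inr : Finset (thetaIndex X).VQ)) b ?_ ?_ ?_
  · -- on `W`: the per-prime (α) and place sum, dictionary read at `p ∈ U` through its bad fibre point
    intro i vQ hvQ
    obtain ⟨pp, hpp, rfl⟩ := Finset.mem_image.mp hvQ
    obtain ⟨w, hw⟩ := hbadU pp hpp
    exact placeSum_le_cellSlack_at X hlog M archPk archSub Ψ act Mmod region n lat sig split qData tq t htq0 htq1 eK AK BK ϖ mΘ mq s
      ht0 hϖ0 ht1 hΘ hq hs0 hs HB pp (he pp w hw) (hBA pp w hw) (hϖ pp w hw) (hsharp pp w hw) (hrad pp w hw) i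
  · -- off `W`: archimedean packets and primes with no bad place are free
    intro i vQ hvQ
    cases vQ with
    | inl u =>
      exact cellSlack_nonneg_settingPrVolSharp_inl X hlog M archPk archSub Ψ act Mmod region n lat sig split qData tq t htq0 htq1 HB.mono
        HB.finite i u
    | inr pp =>
      have hpp : pp ∉ U := fun h => hvQ (Finset.mem_image.mpr ⟨pp, h, rfl⟩)
      exact cellSlack_nonneg_settingPrVolSharp_of_good X hlog M archPk archSub Ψ act Mmod region n lat sig split qData tq t htq0 htq1
        HB.mono HB.finite ht1 pp (hgood pp hpp) i
  · -- the total: swap labels and places — the place weights do not read the label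
    have hfs : ∀ i, ∑ vQ ∈ (U.image Sum.inr : Finset (thetaIndex X).VQ), b i vQ = ∑ pp ∈ U, b i (.inr pp) := fun i =>
      Finset.sum_image fun x _ y _ h => Sum.inr_injective h
    rw [Finset.sum_congr rfl fun i _ => hfs i, Finset.sum_comm]
    refine Finset.sum_nonneg fun pp _ => ?_
    show (0 : ℝ) ≤ ∑ i : Fin (thetaIndex X).lstar, Real.log ((pp : ℕ) : ℝ) / (eK pp : ℝ) *
      ∑ v : ↥(placesOver F pp), weight F v.1 * (s pp i ((fibreEquivPlacesOver X pp).symm v) : ℝ)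
    rw [← Finset.mul_sum, Finset.sum_comm]
    refine mul_nonneg (div_nonneg (Real.log_nonneg (by exact_mod_cast pp.2.one_lt.le)) (by positivity))
      (Finset.sum_nonneg fun v _ => ?_)
    rw [← Finset.mul_sum]
    refine mul_nonneg (weight_nonneg F _) ?_
    by_cases hbad : placeOf X pp.1 ((fibreEquivPlacesOver X pp).symm v) ∈ X.S
    · exact hled pp _ hbad
    · exact (Finset.sum_eq_zero fun i _ => by rw [hs0 pp i _ hbad, Int.cast_zero]).ge

/-! ## §2. THE ROW-27 DOOR, W-RELATIVE: `HStarReachLedger ⟹ Statement`, everything asked at the bad primes only -/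

open scoped Classical in
/-- **THE ROW-27 DOOR — `HStarReachLedger ⟹ Cor312.Setting.Statement` at `settingPrVolSharp`, W-RELATIVE.** Bridge hypotheses; `ϖ_x ≠ 0`
everywhere; at the BAD places the REALISING Θ-orders `mΘ = (i+1)²·mq` ([IUTchI] Ex. 3.2 (iv)) read through `ϖ`; and ONLY AT THE PRIMES UNDER A
BAD PLACE: `e_p ≥ 1`, norm uniformizers `‖ϖ_x‖ = p^{−1/e_p}` (`x ∣ p`), an inner certificate `A_p` (a NON-log-unit of valuation `≥ A_p − 1` at
every `x ∣ p`), an outer certificate `B_p` (a log-unit of norm `≥ p^{−B_p/e_p}`), the ledger's columns DOMINATED (`innerCond p e_p ≤ A_p`,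
`B_p ≤ rOutSharp p e_p`, whence `B_p ≤ r_out♯ ≤ 1 ≤ innerCond ≤ A_p`) and the ledger's index `e_w = e_p`. THEN abc-iut-lens-nearmiss-1's candidate
`HStarReachLedger l⋆ Fib bad e mq` implies the typed Corollary `Statement` — gen 0's `statement_of_hStarReachLedger_of_badColumns` (p476177)
with the dictionary itself now W-relative (§1). This is the door the genuine bed consumes with the certificates DISCHARGED off the ties;
which genuine data satisfy H⋆₂₇ is rh-num-1's table, not this file. [cite: Mochizuki2012, IUTchI Ex. 3.2 (iv) p. 71; IUTchIII Rmk. 3.9.3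
pp. 119–120, Cor. 3.12 p. 173–174] [cite: DupuyHilado2025, §3.6, §3.9, §4.9] [claim: Mochizuki2012, status: disputed] -/
theorem statement_of_hStarReachLedger_on (ht0 : ∀ pp i x, t pp i x ≠ 0) (hϖ0 : ∀ pp x, ϖ pp x ≠ 0)
    (ht1 : ∀ (pp : Nat.Primes) (i : Fin X.lstar) (x : (thetaIndex X).Fibre (.inr pp)),
      haveI : Fact (pp : ℕ).Prime := ⟨pp.2⟩; placeOf X pp.1 x ∉ X.S → ‖t pp i x‖ = 1)
    (hΘ : ∀ (pp : Nat.Primes) (i : Fin X.lstar) (w : (thetaIndex X).Fibre (.inr pp)), haveI : Fact (pp : ℕ).Prime := ⟨pp.2⟩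
      placeOf X pp.1 w ∈ X.S → ‖t pp i w‖ = ‖ϖ pp w‖ ^ (mΘ pp i w))
    (hq : ∀ (pp : Nat.Primes) (w : (thetaIndex X).Fibre (.inr pp)), haveI : Fact (pp : ℕ).Prime := ⟨pp.2⟩
      placeOf X pp.1 w ∈ X.S → ‖tq pp w‖ = ‖ϖ pp w‖ ^ (mq pp w))
    (hmΘ : ∀ (pp : Nat.Primes) (i : Fin (thetaIndex X).lstar) (w : (thetaIndex X).Fibre (.inr pp)),
      haveI : Fact (pp : ℕ).Prime := ⟨pp.2⟩; placeOf X pp.1 w ∈ X.S → mΘ pp i w = (((i : ℕ) : ℤ) + 1) ^ 2 * mq pp w)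
    (he : ∀ (pp : Nat.Primes) (w : (thetaIndex X).Fibre (.inr pp)), haveI : Fact (pp : ℕ).Prime := ⟨pp.2⟩
      placeOf X pp.1 w ∈ X.S → 1 ≤ eK pp)
    (hϖ : ∀ (pp : Nat.Primes) (w : (thetaIndex X).Fibre (.inr pp)), haveI : Fact (pp : ℕ).Prime := ⟨pp.2⟩
      placeOf X pp.1 w ∈ X.S → ∀ x : (thetaIndex X).Fibre (.inr pp), ‖ϖ pp x‖ = ((pp : ℕ) : ℝ) ^ (-(1 : ℝ) / (eK pp : ℝ)))
    (hsharp : ∀ (pp : Nat.Primes) (w : (thetaIndex X).Fibre (.inr pp)), haveI : Fact (pp : ℕ).Prime := ⟨pp.2⟩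
      placeOf X pp.1 w ∈ X.S → ∀ x : (thetaIndex X).Fibre (.inr pp),
        ∃ u : kOf X pp.1 x, ‖u‖ ≤ ‖ϖ pp x‖ ^ ((AK pp : ℤ) - 1) ∧ u ∉ (logUnits (kOf X pp.1 x) : Set (kOf X pp.1 x)))
    (hrad : ∀ (pp : Nat.Primes) (w : (thetaIndex X).Fibre (.inr pp)), haveI : Fact (pp : ℕ).Prime := ⟨pp.2⟩
      placeOf X pp.1 w ∈ X.S → ∀ x : (thetaIndex X).Fibre (.inr pp),
        ∃ z ∈ (logUnits (kOf X pp.1 x) : Set (kOf X pp.1 x)), ((pp : ℕ) : ℝ) ^ (-(BK pp : ℝ) / (eK pp : ℝ)) ≤ ‖z‖)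
    (hA : ∀ (pp : Nat.Primes) (w : (thetaIndex X).Fibre (.inr pp)), haveI : Fact (pp : ℕ).Prime := ⟨pp.2⟩
      placeOf X pp.1 w ∈ X.S → innerCond pp (eK pp) ≤ (AK pp : ℤ))
    (hB : ∀ (pp : Nat.Primes) (w : (thetaIndex X).Fibre (.inr pp)), haveI : Fact (pp : ℕ).Prime := ⟨pp.2⟩
      placeOf X pp.1 w ∈ X.S → BK pp ≤ rOutSharp pp (eK pp))
    (eL : ∀ pp : Nat.Primes, (thetaIndex X).Fibre (.inr pp) → ℕ)
    (heL : ∀ (pp : Nat.Primes) (w : (thetaIndex X).Fibre (.inr pp)), haveI : Fact (pp : ℕ).Prime := ⟨pp.2⟩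
      placeOf X pp.1 w ∈ X.S → eL pp w = eK pp)
    (hH : HStarReachLedger (thetaIndex X).lstar (fun pp => (thetaIndex X).Fibre (.inr pp))
      (fun pp w => haveI : Fact (pp : ℕ).Prime := ⟨pp.2⟩; placeOf X pp.1 w ∈ X.S) eL mq)
    (HB : BridgeHyps (settingPrVolSharp X hlog M archPk archSub Ψ act Mmod region n lat sig split qData tq t htq0 htq1)) :
    (settingPrVolSharp X hlog M archPk archSub Ψ act Mmod region n lat sig split qData tq t htq0 htq1).Statement :=
  statement_of_placeLedger_on X hlog M archPk archSub Ψ act Mmod region n lat sig split qData tq t htq0 htq1 eK AK BK ϖ mΘ mq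
    (fun pp i x => haveI : Fact (pp : ℕ).Prime := ⟨pp.2⟩
      if placeOf X pp.1 x ∈ X.S then cellReachSlack pp (eK pp) ((i : ℕ) + 1) (mq pp x) else 0)
    ht0 hϖ0 ht1 hΘ hq
    (fun pp i x hx => if_neg hx)
    (fun pp i w hw => by
      have h := cellReachSlack_succ_le_realised pp (eK pp) (he pp w hw) (AK pp) (BK pp) i (mq pp w) (hA pp w hw) (hB pp w hw)
      rw [if_pos hw, hmΘ pp i w hw]
      linarith [h])
    (fun pp w hw => by
      have hcell : LedgerCell (thetaIndex X).lstar pp (eK pp) (mq pp w) := by rw [← heL pp w hw]; exact hH pp w hw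
      have h := sum_cellReachSlack_nonneg_of_ledgerCell (he pp w hw) hcell
      simpa only [if_pos hw] using h)
    he
    (fun pp w hw => (hB pp w hw).trans ((rOutSharp_le_one _ _).trans ((one_le_innerCond _ _ (he pp w hw)).trans (hA pp w hw))))
    hϖ hsharp hrad HB

end Dictionary

end Sharp

end Summit.ABC.IUTFork.Repair.RH.ReachLedgerDoor

end
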